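import Literature.NumberTheory.Sieve.BombieriAsymptoticSieveSigma0
import Literature.NumberTheory.Sieve.BombieriAsymptoticSieveProofs
import HarnessLib

/-!
# Bombieri's asymptotic sieve: Theorem 1, discharged (canonical name)

Topic `Literature/NumberTheory/Sieve`, companion ("Proofs") file of `BombieriAsymptoticSieve.lean`
([BombieriRIMS1977] Theorem p. 5; [FriedlanderIwaniecPisa1978] Theorem 1). The named fact
`Literature.NumberTheory.Sieve.Bombieri1976_asymptotic_sieve` (the corrected statement of Bombieri's asymptotic sieve, scalar
case `k ≥ 2`, vendored because the tree's `Literature.NumberTheory.Sieve.bombieri_asymptotic_sieve` of `ParityBarrier.lean`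
carries different, non-equivalent hypotheses) is a THEOREM of the tree:
`Bombieri1976_asymptotic_sieve_of_lemma10` (`BombieriAsymptoticSieveProofs.lean`: Lemmata 3, 5 (the
fundamental lemma), 6–9, 11, 12 of [FriedlanderIwaniecPisa1978] and the conclusion pp. 739–740,
all proved) applied to `FI1978_lemma10_holds` (`BombieriAsymptoticSieveSigma0.lean`: Lemma 10, the
`Σ₀`-bound, proved; a second proof of its small range is `BombieriSieve.FI1978_lemma10_small`,
`BombieriAsymptoticSieveSigma0SmoothParts.lean`). This file only records the discharge under the
canonical name `Bombieri1976_asymptotic_sieve_holds`; the same term already appears as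
`Literature.NumberTheory.Sieve.bombieri1976_asymptotic_sieve_proved` in `BombieriAsymptoticSieveShiftedPrimesProofs.lean`
(whose docstring reserves the canonical name for this file), so the two are aliases for a
librarian to fold.
-/

namespace Literature.NumberTheory.Sieve

/-- **Bombieri's asymptotic sieve, Theorem 1 (scalar case), DISCHARGED**: under Bombieri's
hypotheses (A₁)–(A₅) (`SieveSequence.IsBombieriSequence`), `A.HasDensityConstant H` and `k ≥ 2`,
`∑_{n ≤ x} a_n Λ_k(n) ∼ k H A(x) (log x)^{k−1}` ([BombieriRIMS1977] Theorem, p. 5;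
[FriedlanderIwaniecPisa1978] p. 722, Theorem 1 (Bombieri)). One line from the tree:
`Bombieri1976_asymptotic_sieve_of_lemma10 FI1978_lemma10_holds`; alias of
`bombieri1976_asymptotic_sieve_proved`. [cite: FriedlanderIwaniecPisa1978, Theorem 1] [cite: BombieriRIMS1977, Theorem (p. 5)] -/
theorem Bombieri1976_asymptotic_sieve_holds : Bombieri1976_asymptotic_sieve :=
  Bombieri1976_asymptotic_sieve_of_lemma10 FI1978_lemma10_holds

end Literature.NumberTheory.Sieve
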